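import Summits.QuantumFields.YangMills.Theorems.BalabanUVNodesN08AlphaEq324RowClassSocketAE

/-!
# Route «BalabanUVNodes», Track-A DAG node N08 = [Balaban1985UV3] Thm 1 p. 257 ∕ Thm 2 p. 272 — THE CLASS SOCKET UP TO A CONTROLLED DISCREPANCY: [Balaban1982Higgs1] (3.24)
# is STABLE under a perturbation of the integral (log-level error `E₁`) and of the cumulant letter (error `E₂`) with `E₁ + E₂` inside the budget — the (α)-row `h324` from an
# APPROXIMATE presentation of the step block, and the plug in the class road's POST-CONSUMER currency (part 4 of the class socket)

Cell `pub-ymgap`, seat `pub-ymgap-dag-n08-w4` gen 5 (INTENT-5).  `bears_on: R4∕N08`; filed `--supports stmt-QuantumFields-27364` (K1⁹, helper).  THEOREMS ONLY (def-free, sorry-free,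
standard axioms); part 1 (`…RowClassSocket`) and gen 0's `…RowSocket.eq324_mono` consumed BY NAME.

WHY (dag-n08-d g14's CHECK C «torus», INBOX l.≈37480, and the collar transfer of CLAIM-71).  Parts 1–3 plug a member that presents the step block EXACTLY (or a.e.).  Two located
situations present it only UP TO A CONTROLLED ERROR: (T2) a wrapped region `Ω_{k+1}(h)` on the torus compared with a cut-open ℤ^d member «by images» (covariances
`O(P_k^d e^{−κP_k})`-close ⇒ `log Z` and the cumulants move by that much); and any transfer of the form `Z' = Z·w`, `e^{−E} ≤ w ≤ e^{E}` (the collar's small-field volume factor is of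
this kind, handled Literature-side by n08-d).  The (3.24) row is an `∃ r, |r| ≤ budget ∧ Z = exp(Σ + r)` statement, so it is STABLE: a reference `Eq324 Z cum n̄ C₁ s κ vol`, a positive
`Z'` with `|log Z' − log Z| ≤ E₁` and a letter `cum'` with `|Σ_{n≤n̄}(cum' n − cum n)∕n!| ≤ E₂`, `E₁ + E₂ ≤ C₂·s^κ·vol`, give `Eq324 Z' cum' n̄ (C₁ + C₂) s κ vol`.  This file records the
algebra and the row-level plug, so that an approximate IDENT costs the (α)-side nothing but the constant `C₁ + C₂ ≤ Ca + Cc`: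
* §1 `log_eq_of_eq324` · ★ `eq324_of_approx` (log-level + letter-level discrepancy) · `abs_log_sub_log_le_of_mul` (`Z' = Z·w`, `e^{−E} ≤ w ≤ e^{E}` ⇒ `|log Z' − log Z| ≤ E`) ·
  `eq324_of_mul_factor` (multiplicative transfer, same letter) · `eq324_of_approx_integral` (same letter, log-level discrepancy only) · `eq324_of_two_sided`
  (`e^{−E}·Z ≤ Z' ≤ e^{E}·Z`).
* §3 ★★★ `h324Row_freeLetter_of_postConsumer_ae` — the row from the class road's OWN output shape (`…KernelEq324.eq324_kernel_noPad`, n08-d p635433 ✓;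
  `…KernelEq324AnyGamma`, n08-b): per `(h, U)`, `0 < ∫Πχ̂_{p(g_k)}e^{H}dμ ∧ |log ∫ − cumulantSum μ H n̄| ≤ C·g_k^{6+2κ₀}·|I|` + a.e. presentation + `|I| ≤ v·|T₁^{(k)}|`, `C·v ≤ Ca + Cc` ⟹ the row at the
  free letter — no sandwich, no class constants on the (α) side.
* §2 ★★ `h324RowAt_of_approxPresentation` — the row `∀ h U, Eq324 (∫ ω in (𝔖 k).box h, e^{𝒱 h U ω} ∂(𝔖 k).μ) (c k h U) n̄ (Ca + Cc) (Lᵏg₀²) (3+κ₀) (S.sites k)` from, per `(h, U)`: a REFERENCE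
  `Eq324 (Z h U) (cref h U) n̄ C₁ (Lᵏg₀²) (3+κ₀) (S.sites k)` (e.g. a class member's, parts 1–3), positivity of the step's box integral, the two discrepancies with `E₁ h U + E₂ h U ≤
  C₂·(Lᵏg₀²)^{3+κ₀}·|T₁^{(k)}|`, and `C₁ + C₂ ≤ Ca + Cc`; ★ `h324RowAt_of_mulFactorPresentation` (the block integral = reference × a factor in `[e^{−E}, e^{E}]`, same letter); ★ `h324RowAt_of_twoSidedPresentation`
  (`e^{−E}·Z ≤ ∫_{box} e^{𝒱} d(𝔖 k).μ ≤ e^{E}·Z` — the currency of a two-member Gaussian comparison on the same window, dag-n08-w5's OFFER (A)).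
HONEST SCOPE.  Real arithmetic over the binder shape; the reference statement, the discrepancy bounds and which comparison (torus images, collar, …) supplies them are HYPOTHESES ∕ NODE 00
business; nothing of [Balaban1985UV3] ∕ [BenfattoEtAl1978] asserted or discharged; `PrintedUV3V` NOT proved; N08 NOT discharged; count-neutral; one finite 𝕋⁴ programme at fixed ε — R4
closes the conditional finite-𝕋⁴ rung `BalabanLadder.UV` only; nothing continuum ∕ ℝ⁴ ∕ OS ∕ mass gap ∕ Clay.

References: [Balaban1985UV3] T. Bałaban, CMP 102 (1985) 255–275 — (58) p. 270; [Balaban1982Higgs1] T. Bałaban, CMP 85 (1982) — (3.24) p. 616; [BenfattoEtAl1978] G. Benfatto et al.,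
CMP 59 (1978) — Lemma p. 152.
-/

noncomputable section

namespace Summit.QuantumFields.YangMills.Theorems.BalabanUVNodesN08AlphaEq324RowClassSocketApprox

open MeasureTheory
open scoped BigOperators Nat
open Literature.MathematicalPhysics.QuantumFieldTheory.Balaban1983to89
open Literature.MathematicalPhysics.QuantumFieldTheory.Balaban1983to89.B1Sect3Statements (Eq324)
open Literature.MathematicalPhysics.QuantumFieldTheory.Balaban1985CMP102.Setting
open Summit.QuantumFields.Balaban3D.Carriers
open Summit.QuantumFields.Balaban3D.Proofs.ScalesArithmetic (g0sq_pos L_pos sites_nonneg)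
open Summit.QuantumFields.Balaban3D.Proofs.Primitives (AlphaConsts)
open Summit.QuantumFields.Balaban3D.Proofs.GroupModelLieC (lieC)
open Literature.MathematicalPhysics.QuantumFieldTheory.Balaban1983to89.B1Eq324BenfattoLemma (smallFieldSet cutoffBoltzmann truncatedExp cumulantSum)
open Literature.MathematicalPhysics.QuantumFieldTheory.Balaban1983to89.B1Eq324CumulantTaylor (eq324_iff_abs_log_sub_le)
open Summit.QuantumFields.Balaban3D.Proofs.ScalesArithmetic (gk_pos)
open Summit.QuantumFields.YangMills.Theorems.BalabanUVNodesN08AlphaEq324RowSocket (eq324_mono)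
open Summit.QuantumFields.YangMills.Theorems.BalabanUVNodesN08AlphaEq324RowCumLetterModel (budget_le_vol gk_rpow_six_add)
open Summit.QuantumFields.YangMills.Theorems.BalabanUVNodesN08AlphaEq324RowClassSocket (integral_cutoffBoltzmann_eq_setIntegral')
open Summit.QuantumFields.YangMills.Theorems.BalabanUVNodesN08AlphaEq324RowClassSocketAE (eq324_box_of_latticePresentation_ae)
open Literature.Probability.LatticeModels (cumulantOf)

variable {L : ℕ}

/-! ## §1 `Eq324` is stable under controlled discrepancies -/

section Algebra

variable {Z Z' : ℝ} {cum cum' : ℕ → ℝ} {nbar : ℕ} {C₁ C₂ s κ vol E E₁ E₂ : ℝ}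

/-- From `Eq324 Z cum n̄ C s κ vol`: `Z > 0` and `log Z = Σ_{n=1}^{n̄} cum n∕n! + r` with `|r| ≤ C·s^κ·vol`. [cite: Balaban1982Higgs1, (3.24) p.616 (bookkeeping)] -/
theorem log_eq_of_eq324 (h : Eq324 Z cum nbar C₁ s κ vol) :
    ∃ r : ℝ, |r| ≤ C₁ * s ^ κ * vol ∧ Real.log Z = ∑ n ∈ Finset.Icc 1 nbar, cum n / (n ! : ℝ) + r := by
  obtain ⟨r, hr, hZ⟩ := h
  exact ⟨r, hr, by rw [hZ, Real.log_exp]⟩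

/-- ★ **`Eq324` UNDER A CONTROLLED DISCREPANCY**: a reference `Eq324 Z cum n̄ C₁ s κ vol`, a positive `Z'` with `|log Z' − log Z| ≤ E₁`, a letter `cum'` with
`|Σ_{n≤n̄} cum' n∕n! − Σ_{n≤n̄} cum n∕n!| ≤ E₂`, and `E₁ + E₂ ≤ C₂·s^κ·vol` give `Eq324 Z' cum' n̄ (C₁ + C₂) s κ vol`.
[cite: Balaban1982Higgs1, (3.24) p.616; Balaban1985UV3, (58) p.270 (bookkeeping)] -/
theorem eq324_of_approx (h : Eq324 Z cum nbar C₁ s κ vol) (hZ' : 0 < Z') (h₁ : |Real.log Z' - Real.log Z| ≤ E₁)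
    (h₂ : |∑ n ∈ Finset.Icc 1 nbar, cum' n / (n ! : ℝ) - ∑ n ∈ Finset.Icc 1 nbar, cum n / (n ! : ℝ)| ≤ E₂) (hE : E₁ + E₂ ≤ C₂ * s ^ κ * vol) :
    Eq324 Z' cum' nbar (C₁ + C₂) s κ vol := by
  obtain ⟨r, hr, hlog⟩ := log_eq_of_eq324 h
  set Tr : ℝ := ∑ n ∈ Finset.Icc 1 nbar, cum n / (n ! : ℝ) with hTr
  set Tn : ℝ := ∑ n ∈ Finset.Icc 1 nbar, cum' n / (n ! : ℝ) with hTn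
  refine ⟨r + (Real.log Z' - Real.log Z) - (Tn - Tr), ?_, ?_⟩
  · have h3a : |r + (Real.log Z' - Real.log Z) - (Tn - Tr)| ≤ |r + (Real.log Z' - Real.log Z)| + |Tn - Tr| := abs_sub _ _
    have h3b : |r + (Real.log Z' - Real.log Z)| ≤ |r| + |Real.log Z' - Real.log Z| := abs_add_le _ _
    have h4 : |r + (Real.log Z' - Real.log Z) - (Tn - Tr)| ≤ C₁ * s ^ κ * vol + C₂ * s ^ κ * vol := by linarith
    calc |r + (Real.log Z' - Real.log Z) - (Tn - Tr)| ≤ C₁ * s ^ κ * vol + C₂ * s ^ κ * vol := h4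
      _ = (C₁ + C₂) * s ^ κ * vol := by ring
  · have key : Real.log Z' = Tn + (r + (Real.log Z' - Real.log Z) - (Tn - Tr)) := by rw [hlog]; ring
    rw [← hTn, ← key, Real.exp_log hZ']

/-- `Z' = Z·w` with `e^{−E} ≤ w ≤ e^{E}` and `Z > 0` ⇒ `0 < Z'` and `|log Z' − log Z| ≤ E`. [folklore] -/
theorem abs_log_sub_log_le_of_mul {w : ℝ} (hZ : 0 < Z) (hw₁ : Real.exp (-E) ≤ w) (hw₂ : w ≤ Real.exp E) (hZ' : Z' = Z * w) :
    0 < Z' ∧ |Real.log Z' - Real.log Z| ≤ E := by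
  have hw : 0 < w := lt_of_lt_of_le (Real.exp_pos _) hw₁
  refine ⟨by rw [hZ']; exact mul_pos hZ hw, ?_⟩
  rw [hZ', Real.log_mul hZ.ne' hw.ne', add_sub_cancel_left]
  refine abs_le.mpr ⟨?_, ?_⟩
  · have := Real.log_le_log (Real.exp_pos _) hw₁
    rwa [Real.log_exp] at this
  · have := Real.log_le_log hw hw₂
    rwa [Real.log_exp] at this

/-- **Multiplicative transfer, same letter**: `Eq324 Z cum n̄ C₁ s κ vol`, `Z' = Z·w`, `e^{−E} ≤ w ≤ e^{E}`, `E ≤ C₂·s^κ·vol` ⇒ `Eq324 Z' cum n̄ (C₁ + C₂) s κ vol` (the shape of the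
collar's volume factor and of a comparison of partition functions). [cite: Balaban1982Higgs1, (3.24) p.616 (bookkeeping)] -/
theorem eq324_of_mul_factor {w : ℝ} (h : Eq324 Z cum nbar C₁ s κ vol) (hw₁ : Real.exp (-E) ≤ w) (hw₂ : w ≤ Real.exp E) (hZ' : Z' = Z * w)
    (hE : E ≤ C₂ * s ^ κ * vol) : Eq324 Z' cum nbar (C₁ + C₂) s κ vol := by
  obtain ⟨hpos, hlog⟩ := abs_log_sub_log_le_of_mul h.pos hw₁ hw₂ hZ'
  exact eq324_of_approx h hpos hlog (E₂ := 0) (by rw [sub_self, abs_zero]) (by linarith)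

/-- **Log-level discrepancy only, same letter**: `Eq324 Z cum n̄ C₁ s κ vol`, `0 < Z'`, `|log Z' − log Z| ≤ E ≤ C₂·s^κ·vol` ⇒ `Eq324 Z' cum n̄ (C₁ + C₂) s κ vol`.
[cite: Balaban1982Higgs1, (3.24) p.616 (bookkeeping)] -/
theorem eq324_of_approx_integral (h : Eq324 Z cum nbar C₁ s κ vol) (hZ' : 0 < Z') (h₁ : |Real.log Z' - Real.log Z| ≤ E) (hE : E ≤ C₂ * s ^ κ * vol) :
    Eq324 Z' cum nbar (C₁ + C₂) s κ vol :=
  eq324_of_approx h hZ' h₁ (E₂ := 0) (by rw [sub_self, abs_zero]) (by linarith)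

/-- **Two-sided comparison, same letter**: `Eq324 Z cum n̄ C₁ s κ vol`, `e^{−E}·Z ≤ Z' ≤ e^{E}·Z`, `E ≤ C₂·s^κ·vol` ⇒ `Eq324 Z' cum n̄ (C₁ + C₂) s κ vol` — the shape in
which a comparison of two Gaussian members on the same window delivers the integral (dag-n08-w5's two-member comparison; CHECK C out (T2)).
[cite: Balaban1982Higgs1, (3.24) p.616 (bookkeeping)] -/
theorem eq324_of_two_sided (h : Eq324 Z cum nbar C₁ s κ vol) (hlow : Real.exp (-E) * Z ≤ Z') (hup : Z' ≤ Real.exp E * Z)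
    (hE : E ≤ C₂ * s ^ κ * vol) : Eq324 Z' cum nbar (C₁ + C₂) s κ vol := by
  have hZ : 0 < Z := h.pos
  have hw₁ : Real.exp (-E) ≤ Z' / Z := by rw [le_div_iff₀ hZ]; exact hlow
  have hw₂ : Z' / Z ≤ Real.exp E := by rw [div_le_iff₀ hZ]; exact hup
  exact eq324_of_mul_factor h hw₁ hw₂ (by rw [mul_div_cancel₀ _ hZ.ne']) hE

end Algebra

/-! ## §2 The (3.24) row of the edited clauses from an APPROXIMATE presentation -/

section Row

variable {S : Scales L} {G : Type} [GaugeGroup G] [MeasurableSpace G] [HaarData G] (𝔊 : GroupModel G) (𝔠 : AlphaConsts L 𝔊.N)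
  (𝔖 : ∀ k, StepSeries S G ↥(lieC 𝔊) (nblkOf S 𝔠.lane.carrier k) k) (k : ℕ)
  (c : Hist S.P (k + 1) → GaugeField S.P (k + 1) G → ℕ → ℝ)

/-- ★★ **THE (3.24) ROW FROM AN APPROXIMATE PRESENTATION.**  Per `(h, U)`: a REFERENCE statement `Eq324 (Z h U) (cref h U) n̄ C₁ (Lᵏg₀²) (3+κ₀) (S.sites k)` (a class member's, a
cut-open torus member's, …), the step's own box integral positive and log-close to `Z h U` (`≤ E₁ h U`), the step's letter `c h U` close to `cref h U` in the `Σ_{n≤n̄} ·∕n!` functional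
(`≤ E₂ h U`), `E₁ h U + E₂ h U ≤ C₂·(Lᵏg₀²)^{3+κ₀}·|T₁^{(k)}|`, and `C₁ + C₂ ≤ Ca + Cc` — give the row `StepAlphaEq324CoreLTAtAC.h324` ∕ `StepAlphaEq324CoreLTAt.h324` at the letter `c`
VERBATIM.  Which comparison supplies `E₁, E₂` (torus images (T2), collars, …) is NODE 00 business.
[cite: Balaban1985UV3, (58) p.270; Balaban1982Higgs1, (3.24) p.616] -/
theorem h324RowAt_of_approxPresentation (Z : Hist S.P (k + 1) → GaugeField S.P (k + 1) G → ℝ)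
    (cref : Hist S.P (k + 1) → GaugeField S.P (k + 1) G → ℕ → ℝ) (E₁ E₂ : Hist S.P (k + 1) → GaugeField S.P (k + 1) G → ℝ) {C₁ C₂ : ℝ}
    (href : ∀ h U, Eq324 (Z h U) (cref h U) 𝔠.nbar C₁ ((L : ℝ) ^ k * S.g0sq) (3 + 𝔠.κ₀) (S.sites k))
    (hpos : ∀ h (U : GaugeField S.P (k + 1) G), 0 < ∫ ω in (𝔖 k).box h, Real.exp ((𝔖 k).𝒱 h U ω) ∂(𝔖 k).μ)
    (h₁ : ∀ h (U : GaugeField S.P (k + 1) G), |Real.log (∫ ω in (𝔖 k).box h, Real.exp ((𝔖 k).𝒱 h U ω) ∂(𝔖 k).μ) - Real.log (Z h U)| ≤ E₁ h U)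
    (h₂ : ∀ h U, |∑ n ∈ Finset.Icc 1 𝔠.nbar, c h U n / (n ! : ℝ) - ∑ n ∈ Finset.Icc 1 𝔠.nbar, cref h U n / (n ! : ℝ)| ≤ E₂ h U)
    (hE : ∀ h U, E₁ h U + E₂ h U ≤ C₂ * ((L : ℝ) ^ k * S.g0sq) ^ (3 + 𝔠.κ₀) * S.sites k) (hC : C₁ + C₂ ≤ 𝔠.Ca + 𝔠.Cc) :
    ∀ h (U : GaugeField S.P (k + 1) G),
      Eq324 (∫ ω in (𝔖 k).box h, Real.exp ((𝔖 k).𝒱 h U ω) ∂(𝔖 k).μ) (c h U) 𝔠.nbar (𝔠.Ca + 𝔠.Cc) ((L : ℝ) ^ k * S.g0sq) (3 + 𝔠.κ₀) (S.sites k) := by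
  intro h U
  have hunit : 0 ≤ ((L : ℝ) ^ k * S.g0sq) ^ (3 + 𝔠.κ₀) * S.sites k :=
    mul_nonneg (Real.rpow_nonneg (mul_pos (pow_pos (L_pos S) k) (g0sq_pos S)).le _) (sites_nonneg S k)
  refine eq324_mono (eq324_of_approx (href h U) (hpos h U) (h₁ h U) (h₂ h U) (hE h U)) ?_
  calc (C₁ + C₂) * ((L : ℝ) ^ k * S.g0sq) ^ (3 + 𝔠.κ₀) * S.sites k = (C₁ + C₂) * (((L : ℝ) ^ k * S.g0sq) ^ (3 + 𝔠.κ₀) * S.sites k) := by ring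
    _ ≤ (𝔠.Ca + 𝔠.Cc) * (((L : ℝ) ^ k * S.g0sq) ^ (3 + 𝔠.κ₀) * S.sites k) := mul_le_mul_of_nonneg_right hC hunit
    _ = (𝔠.Ca + 𝔠.Cc) * ((L : ℝ) ^ k * S.g0sq) ^ (3 + 𝔠.κ₀) * S.sites k := by ring

/-- ★ **THE (3.24) ROW WHEN THE BLOCK INTEGRAL IS THE REFERENCE TIMES A CONTROLLED FACTOR** (same letter): per `(h, U)`, `Eq324 (Z h U) (c h U) n̄ C₁ …`,
`∫_{box h} e^{𝒱 h U} d(𝔖 k).μ = Z h U · w h U` with `e^{−E h U} ≤ w h U ≤ e^{E h U}`, `E h U ≤ C₂·(Lᵏg₀²)^{3+κ₀}·|T₁^{(k)}|`, `C₁ + C₂ ≤ Ca + Cc` ⇒ the row at `c`.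
[cite: Balaban1985UV3, (58) p.270; Balaban1982Higgs1, (3.24) p.616] -/
theorem h324RowAt_of_mulFactorPresentation (Z w E : Hist S.P (k + 1) → GaugeField S.P (k + 1) G → ℝ) {C₁ C₂ : ℝ}
    (href : ∀ h U, Eq324 (Z h U) (c h U) 𝔠.nbar C₁ ((L : ℝ) ^ k * S.g0sq) (3 + 𝔠.κ₀) (S.sites k))
    (hw₁ : ∀ h U, Real.exp (-E h U) ≤ w h U) (hw₂ : ∀ h U, w h U ≤ Real.exp (E h U))
    (hZ' : ∀ h (U : GaugeField S.P (k + 1) G), ∫ ω in (𝔖 k).box h, Real.exp ((𝔖 k).𝒱 h U ω) ∂(𝔖 k).μ = Z h U * w h U)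
    (hE : ∀ h U, E h U ≤ C₂ * ((L : ℝ) ^ k * S.g0sq) ^ (3 + 𝔠.κ₀) * S.sites k) (hC : C₁ + C₂ ≤ 𝔠.Ca + 𝔠.Cc) :
    ∀ h (U : GaugeField S.P (k + 1) G),
      Eq324 (∫ ω in (𝔖 k).box h, Real.exp ((𝔖 k).𝒱 h U ω) ∂(𝔖 k).μ) (c h U) 𝔠.nbar (𝔠.Ca + 𝔠.Cc) ((L : ℝ) ^ k * S.g0sq) (3 + 𝔠.κ₀) (S.sites k) := by
  intro h U
  have hunit : 0 ≤ ((L : ℝ) ^ k * S.g0sq) ^ (3 + 𝔠.κ₀) * S.sites k :=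
    mul_nonneg (Real.rpow_nonneg (mul_pos (pow_pos (L_pos S) k) (g0sq_pos S)).le _) (sites_nonneg S k)
  refine eq324_mono (eq324_of_mul_factor (href h U) (hw₁ h U) (hw₂ h U) (hZ' h U) (hE h U)) ?_
  calc (C₁ + C₂) * ((L : ℝ) ^ k * S.g0sq) ^ (3 + 𝔠.κ₀) * S.sites k = (C₁ + C₂) * (((L : ℝ) ^ k * S.g0sq) ^ (3 + 𝔠.κ₀) * S.sites k) := by ring
    _ ≤ (𝔠.Ca + 𝔠.Cc) * (((L : ℝ) ^ k * S.g0sq) ^ (3 + 𝔠.κ₀) * S.sites k) := mul_le_mul_of_nonneg_right hC hunit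
    _ = (𝔠.Ca + 𝔠.Cc) * ((L : ℝ) ^ k * S.g0sq) ^ (3 + 𝔠.κ₀) * S.sites k := by ring

/-- ★ **THE (3.24) ROW FROM A TWO-SIDED COMPARISON OF THE BLOCK INTEGRAL WITH A REFERENCE** (same letter): per `(h, U)`, `Eq324 (Z h U) (c h U) n̄ C₁ …`,
`e^{−E h U}·Z h U ≤ ∫_{box h} e^{𝒱 h U} d(𝔖 k).μ ≤ e^{E h U}·Z h U`, `E h U ≤ C₂·(Lᵏg₀²)^{3+κ₀}·|T₁^{(k)}|`, `C₁ + C₂ ≤ Ca + Cc` ⇒ the row at `c` — the currency of a two-member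
Gaussian comparison on the same window. [cite: Balaban1985UV3, (58) p.270; Balaban1982Higgs1, (3.24) p.616] -/
theorem h324RowAt_of_twoSidedPresentation (Z E : Hist S.P (k + 1) → GaugeField S.P (k + 1) G → ℝ) {C₁ C₂ : ℝ}
    (href : ∀ h U, Eq324 (Z h U) (c h U) 𝔠.nbar C₁ ((L : ℝ) ^ k * S.g0sq) (3 + 𝔠.κ₀) (S.sites k))
    (hlow : ∀ h (U : GaugeField S.P (k + 1) G), Real.exp (-E h U) * Z h U ≤ ∫ ω in (𝔖 k).box h, Real.exp ((𝔖 k).𝒱 h U ω) ∂(𝔖 k).μ)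
    (hup : ∀ h (U : GaugeField S.P (k + 1) G), ∫ ω in (𝔖 k).box h, Real.exp ((𝔖 k).𝒱 h U ω) ∂(𝔖 k).μ ≤ Real.exp (E h U) * Z h U)
    (hE : ∀ h U, E h U ≤ C₂ * ((L : ℝ) ^ k * S.g0sq) ^ (3 + 𝔠.κ₀) * S.sites k) (hC : C₁ + C₂ ≤ 𝔠.Ca + 𝔠.Cc) :
    ∀ h (U : GaugeField S.P (k + 1) G),
      Eq324 (∫ ω in (𝔖 k).box h, Real.exp ((𝔖 k).𝒱 h U ω) ∂(𝔖 k).μ) (c h U) 𝔠.nbar (𝔠.Ca + 𝔠.Cc) ((L : ℝ) ^ k * S.g0sq) (3 + 𝔠.κ₀) (S.sites k) := by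
  intro h U
  have hunit : 0 ≤ ((L : ℝ) ^ k * S.g0sq) ^ (3 + 𝔠.κ₀) * S.sites k :=
    mul_nonneg (Real.rpow_nonneg (mul_pos (pow_pos (L_pos S) k) (g0sq_pos S)).le _) (sites_nonneg S k)
  refine eq324_mono (eq324_of_two_sided (href h U) (hlow h U) (hup h U) (hE h U)) ?_
  calc (C₁ + C₂) * ((L : ℝ) ^ k * S.g0sq) ^ (3 + 𝔠.κ₀) * S.sites k = (C₁ + C₂) * (((L : ℝ) ^ k * S.g0sq) ^ (3 + 𝔠.κ₀) * S.sites k) := by ring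
    _ ≤ (𝔠.Ca + 𝔠.Cc) * (((L : ℝ) ^ k * S.g0sq) ^ (3 + 𝔠.κ₀) * S.sites k) := mul_le_mul_of_nonneg_right hC hunit
    _ = (𝔠.Ca + 𝔠.Cc) * ((L : ℝ) ^ k * S.g0sq) ^ (3 + 𝔠.κ₀) * S.sites k := by ring

end Row

/-! ## §3 The plug in the class road's POST-CONSUMER currency (the conclusion shape of `…KernelEq324.eq324_kernel_noPad`) -/

section PostConsumer

variable {d : ℕ} {S : Scales L} {G : Type} [GaugeGroup G] [MeasurableSpace G] [HaarData G] (𝔊 : GroupModel G) (𝔠 : AlphaConsts L 𝔊.N)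
  (𝔖 : ∀ k, StepSeries S G ↥(lieC 𝔊) (nblkOf S 𝔠.lane.carrier k) k) (k : ℕ)

/-- ★★★ **THE (α)-ROW `h324` FROM THE CLASS ROAD's OWN OUTPUT SHAPE.**  The class road delivers (3.24) for the Gaussian field of a member ALREADY CONSUMED:
`…KernelEq324.eq324_kernel_noPad` ∕ `…KernelEq324AnyGamma` give, for `η ≤ η₀` and every member and instance, `0 < ∫Πχ̂_{p(η)} e^{H} dμ_K ∧ |log ∫ − cumulantSum μ_K H t| ≤ C·η^κ·|I|`.
Read at `η := g_k`, `t := n̄`, `κ := 6 + 2κ₀`, this pair — for the presenting members `μ h U`, ANY Hamiltonians `H h U`, cut-off sets `I h U` with `|I h U| ≤ v·|T₁^{(k)}|`, a constant with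
`C·v ≤ Ca + Cc` — together with the a.e. presentation `(𝔖 k).μ = (μ h U).map (Φ h U)`, `(Φ h U)⁻¹'(box h) =ᵐ smallFieldSet (I h U) (p(g_k))`, `𝒱 h U ∘ Φ h U =ᵐ H h U`, gives the row
`StepAlphaEq324CoreLTAtAC.h324` ∕ `StepAlphaEq324CoreLTAt.h324` at the free letter (`eq324_iff_abs_log_sub_le` + `gk_rpow_six_add` ∘ `budget_le_vol` + part 2's `eq324_box_of_latticePresentation_ae`).
[cite: Balaban1985UV3, (41) p.266 + (58) p.270; Balaban1982Higgs1, (3.24) p.616; BenfattoEtAl1978, Lemma p.152 (class form; ours)] -/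
theorem h324Row_freeLetter_of_postConsumer_ae {v C b₀ p₀ : ℝ} (hC : 0 ≤ C) (hCv : C * v ≤ 𝔠.Ca + 𝔠.Cc)
    (μ : Hist S.P (k + 1) → GaugeField S.P (k + 1) G → Measure ((Fin d → ℤ) → ℝ))
    (Φ : Hist S.P (k + 1) → GaugeField S.P (k + 1) G → ((Fin d → ℤ) → ℝ) → (𝔖 k).Fl) (hΦ : ∀ h U, Measurable (Φ h U))
    (hμ : ∀ h U, (𝔖 k).μ = (μ h U).map (Φ h U)) (hboxm : ∀ h, MeasurableSet ((𝔖 k).box h)) (hVm : ∀ h U, Measurable ((𝔖 k).𝒱 h U))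
    (I : Hist S.P (k + 1) → GaugeField S.P (k + 1) G → Finset (Fin d → ℤ))
    (hbox : ∀ h U, Φ h U ⁻¹' (𝔖 k).box h =ᵐ[μ h U] smallFieldSet (I h U) (B10.pFun b₀ p₀ (S.gk k)))
    (H : Hist S.P (k + 1) → GaugeField S.P (k + 1) G → ((Fin d → ℤ) → ℝ) → ℝ) (hV : ∀ h U, (fun z => (𝔖 k).𝒱 h U (Φ h U z)) =ᵐ[μ h U] H h U)
    (hI : ∀ h U, ((I h U).card : ℝ) ≤ v * S.sites k)
    (hout : ∀ h U, 0 < ∫ z, cutoffBoltzmann (H h U) (I h U) (B10.pFun b₀ p₀ (S.gk k)) z ∂μ h U ∧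
      |Real.log (∫ z, cutoffBoltzmann (H h U) (I h U) (B10.pFun b₀ p₀ (S.gk k)) z ∂μ h U) - cumulantSum (μ h U) (H h U) 𝔠.nbar| ≤
        C * S.gk k ^ (6 + 2 * 𝔠.κ₀) * (I h U).card) :
    ∀ h (U : GaugeField S.P (k + 1) G), Eq324 (∫ ω in (𝔖 k).box h, Real.exp ((𝔖 k).𝒱 h U ω) ∂(𝔖 k).μ)
      (fun n => cumulantOf (fun m => ∫ ω, (𝔖 k).𝒱 h U ω ^ m ∂(𝔖 k).μ) n) 𝔠.nbar (𝔠.Ca + 𝔠.Cc) ((L : ℝ) ^ k * S.g0sq) (3 + 𝔠.κ₀) (S.sites k) := by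
  intro h U
  obtain ⟨hpos, habs⟩ := hout h U
  rw [integral_cutoffBoltzmann_eq_setIntegral'] at hpos habs
  have h1 : Eq324 (∫ z in smallFieldSet (I h U) (B10.pFun b₀ p₀ (S.gk k)), Real.exp (H h U z) ∂μ h U) (fun n => truncatedExp (μ h U) (H h U) n)
      𝔠.nbar C (S.gk k) (6 + 2 * 𝔠.κ₀) (I h U).card := by
    rw [eq324_iff_abs_log_sub_le hpos]
    simpa only [cumulantSum] using habs
  have h2 : Eq324 (∫ z in smallFieldSet (I h U) (B10.pFun b₀ p₀ (S.gk k)), Real.exp (H h U z) ∂μ h U) (fun n => truncatedExp (μ h U) (H h U) n)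
      𝔠.nbar (𝔠.Ca + 𝔠.Cc) ((L : ℝ) ^ k * S.g0sq) (3 + 𝔠.κ₀) (S.sites k) := by
    refine eq324_mono h1 ?_
    rw [gk_rpow_six_add]
    exact budget_le_vol hC (mul_pos (pow_pos (L_pos S) k) (g0sq_pos S)) (sites_nonneg S k) (hI h U) hCv
  exact eq324_box_of_latticePresentation_ae (μ h U) (hΦ h U) (hμ h U) (hboxm h) (hVm h U) (hbox h U) (hV h U) h2

end PostConsumer

end Summit.QuantumFields.YangMills.Theorems.BalabanUVNodesN08AlphaEq324RowClassSocketApprox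

end
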